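import Mathlib.Data.ZMod.Basic
import Summits.ValiantsHypothesis.ValiantsHypothesis.Theorems.DivisionGapZeroOneTransferStubPickParityAux5
import HarnessLib

/-!
# `stub_pickParity`: Pick's theorem mod 4 for simple closed walks on the triangular lattice

Final file of the registered stub `stub_pickParity` of line `charged-uncharged` of crux
`ZeroOneTransfer` (stmt-ValiantsHypothesis-5066, route DivisionGap) — the lattice-topology input of
Kasteleyn's theorem for Valiant's rhombus dimers (`stub_rhombusKasteleyn` consumes this statement
verbatim; with `stub_kasteleynDetSq`, `stub_sqrtCheap`, `stub_dimerFamilyVP` it yields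
`IsVPFamily_ℂ (D_n)`, the hypothesis `hVP` of the route's kill criterion
`ZeroOneTransfer.Negative.zeroOneTransfer_false_of_triangularDimers_hard`).

**Statement.** A closed walk `v` of even period `ℓ ≥ 4` on the triangular lattice (unit steps
`±(1,0)`, `±(0,1)`, `±(1,-1)` on `ℤ²`), simple (injective on one period), contained in a box whose
off-walk lattice points are paired by a map `g` into off-walk lattice neighbours (`g (g u) = u`),
has shoelace sum `Σ_{j<ℓ} (x_j y_{j+1} - x_{j+1} y_j) ≡ ℓ + 2 (mod 4)`.

**Proof** (assembled from `…StubPickParityAux1–5.lean`, vocabulary `…TriWalkDefs.lean`).  With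
`I = Σ_{u ∈ box, u ∉ walk} W₁ u` (winding numbers of the off-walk lattice points), `R` the constant
right winding number and `S` the shoelace sum, Pick's theorem in winding form
(`TriWalk.eight_mul_sum_W_notMem`) reads `8 I = 4 S - ℓ (8 R + 4) + Σ turn`, and Hopf's Umlaufsatz
(`TriWalk.sum_turn_eq`) gives `Σ turn = ±8`.  The pairing makes `I` even: `u ↦ g u` (or `u ↦ u`
when `g u` leaves the box, in which case `W₁ u = W₁ (g u) = 0`) is an involution of the off-walk
points of the box preserving `W₁` (`TriWalk.W₁_eq_of_notMem`), so the sum vanishes in `ZMod 2`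
(`Finset.sum_involution`).  With `ℓ = 2k` and `I = 2I'`: `S = 4 I' + 4 k R + 2 k ∓ 2 ≡ ℓ + 2 (mod 4)`.
[cite: Kasteleyn1961] [cite: Kenyon2009, §3.3] [cite: Hopf1935, Satz I]
-/

namespace Summit.ValiantsHypothesis.ValiantsHypothesis.Theorems.DivisionGapZeroOneTransfer

-- the single-problem summit's namespace `Summit.ValiantsHypothesis.ValiantsHypothesis` repeats
set_option linter.dupNamespace false

open Finset Literature.Probability.LatticeModels

/-- **Pick's theorem mod 4 on the triangular lattice** (registered stub `stub_pickParity` of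
stmt-ValiantsHypothesis-5066, verbatim): a simple closed walk of even period `ℓ ≥ 4` with unit steps
`±(1,0), ±(0,1), ±(1,-1)`, lying in the box `[P₀,P₁] × [Q₀,Q₁]` whose off-walk lattice points are
paired by `g` into off-walk lattice neighbours, has shoelace sum `≡ ℓ + 2 (mod 4)`.
[cite: Kasteleyn1961] [cite: Hopf1935, Satz I] -/
theorem stub_pickParity :
    ∀ (ℓ : ℕ) (v : ℕ → ℤ × ℤ), 4 ≤ ℓ → Even ℓ → (∀ j, v (j + ℓ) = v j) →
      (∀ j, v (j + 1) = v j + (1, 0) ∨ v j = v (j + 1) + (1, 0) ∨ v (j + 1) = v j + (0, 1) ∨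
        v j = v (j + 1) + (0, 1) ∨ v (j + 1) = v j + (1, -1) ∨ v j = v (j + 1) + (1, -1)) →
      (∀ i j, i < ℓ → j < ℓ → v i = v j → i = j) →
      ∀ (P₀ P₁ Q₀ Q₁ : ℤ), (∀ j, P₀ ≤ (v j).1 ∧ (v j).1 ≤ P₁ ∧ Q₀ ≤ (v j).2 ∧ (v j).2 ≤ Q₁) →
      ∀ g : ℤ × ℤ → ℤ × ℤ,
        (∀ u : ℤ × ℤ, P₀ ≤ u.1 → u.1 ≤ P₁ → Q₀ ≤ u.2 → u.2 ≤ Q₁ → (∀ j, v j ≠ u) →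
          (g u = u + (1, 0) ∨ u = g u + (1, 0) ∨ g u = u + (0, 1) ∨ u = g u + (0, 1) ∨
            g u = u + (1, -1) ∨ u = g u + (1, -1)) ∧ (∀ j, v j ≠ g u) ∧ g (g u) = u) →
        (4 : ℤ) ∣ (∑ j ∈ Finset.range ℓ, ((v j).1 * (v (j + 1)).2 - (v (j + 1)).1 * (v j).2)) - (ℓ + 2) := by
  intro ℓ v h4 hev hper hstep hinj P₀ P₁ Q₀ Q₁ hbox g hg
  -- the walk as a `TriWalk`
  let c : TriWalk ℓ := ⟨v, hper, hstep⟩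
  have hcv : ∀ j, c.v j = v j := fun j => rfl
  have hn : 3 ≤ ℓ := by omega
  have hn0 : 0 < ℓ := by omega
  -- simplicity modulo the period
  have hs : ∀ i j, c.v i = c.v j → i % ℓ = j % ℓ := by
    intro i j h
    apply hinj _ _ (Nat.mod_lt _ hn0) (Nat.mod_lt _ hn0)
    rw [← hcv, ← hcv, c.v_mod, c.v_mod]
    exact h
  have hX : ∀ j, P₀ ≤ (c.v j).1 ∧ (c.v j).1 ≤ P₁ := fun j => ⟨(hbox j).1, (hbox j).2.1⟩
  have hY : ∀ j, Q₀ ≤ (c.v j).2 ∧ (c.v j).2 ≤ Q₁ := fun j => ⟨(hbox j).2.2.1, (hbox j).2.2.2⟩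
  -- Pick in winding form and the Umlaufsatz
  have h8 := c.eight_mul_sum_W_notMem hs hn hX hY
  have hT := c.sum_turn_eq hs hn
  -- off-walk points of the box
  set B : Finset (ℤ × ℤ) := Icc P₀ P₁ ×ˢ Icc Q₀ Q₁ with hB
  have hnot : ∀ {u : ℤ × ℤ}, u ∉ (range ℓ).image c.v → ∀ j, v j ≠ u := by
    intro u hu j hj
    apply hu
    exact mem_image.2 ⟨j % ℓ, mem_range.2 (Nat.mod_lt _ hn0), by rw [c.v_mod]; exact hj⟩
  have hmem_of : ∀ {u : ℤ × ℤ}, (∀ j, v j ≠ u) → u ∉ (range ℓ).image c.v := by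
    intro u hu h
    obtain ⟨j, -, hj⟩ := mem_image.1 h
    exact hu j hj
  -- the pairing makes the off-walk winding sum even
  have heven : (2 : ℤ) ∣ ∑ u ∈ B.filter (fun u => u ∉ (range ℓ).image c.v), c.W₁ u.1 u.2 := by
    have h2 : ∀ x : ZMod 2, x + x = 0 := by decide
    have key : ∑ u ∈ B.filter (fun u => u ∉ (range ℓ).image c.v), (c.W₁ u.1 u.2 : ZMod 2) = 0 := by
      refine Finset.sum_involution (fun u _ => if g u ∈ B then g u else u) ?_ ?_ ?_ ?_
      · -- `W₁ u = W₁ (g u)` (or the point is fixed)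
        intro u hu
        obtain ⟨huB, huN⟩ := mem_filter.1 hu
        simp only [hB, mem_product, mem_Icc] at huB
        obtain ⟨hadj, hgN, -⟩ := hg u huB.1.1 huB.1.2 huB.2.1 huB.2.2 (hnot huN)
        split_ifs with hgB
        · rw [c.W₁_eq_of_notMem (hnot huN) hgN hadj]; exact h2 _
        · exact h2 _
      · -- no fixed point carries a nonzero summand
        intro u hu hne
        obtain ⟨huB, huN⟩ := mem_filter.1 hu
        simp only [hB, mem_product, mem_Icc] at huB
        obtain ⟨hadj, hgN, -⟩ := hg u huB.1.1 huB.1.2 huB.2.1 huB.2.2 (hnot huN)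
        split_ifs with hgB
        · intro h
          rcases hadj with e | e | e | e | e | e <;> rw [h] at e <;>
            simp [Prod.ext_iff] at e
        · exfalso
          apply hne
          rw [c.W₁_eq_of_notMem (hnot huN) hgN hadj]
          have : c.W₁ (g u).1 (g u).2 = 0 := by
            refine c.W₁_eq_zero_of_notMem_box hX hY fun h => hgB ?_
            simp only [hB, mem_product, mem_Ico, mem_Icc] at h ⊢
            exact ⟨⟨h.1.1, h.1.2.le⟩, h.2.1, h.2.2.le⟩
          rw [this, Int.cast_zero]
      · -- the partner is again an off-walk point of the box
        intro u hu
        obtain ⟨huB, huN⟩ := mem_filter.1 hu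
        have huB' := huB
        simp only [hB, mem_product, mem_Icc] at huB'
        obtain ⟨-, hgN, -⟩ := hg u huB'.1.1 huB'.1.2 huB'.2.1 huB'.2.2 (hnot huN)
        split_ifs with hgB
        · exact mem_filter.2 ⟨hgB, hmem_of hgN⟩
        · exact hu
      · -- involutive
        intro u hu
        obtain ⟨huB, huN⟩ := mem_filter.1 hu
        have huB' := huB
        simp only [hB, mem_product, mem_Icc] at huB'
        obtain ⟨-, -, hgg⟩ := hg u huB'.1.1 huB'.1.2 huB'.2.1 huB'.2.2 (hnot huN)
        by_cases hgB : g u ∈ B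
        · rw [if_pos hgB, if_pos (by rw [hgg]; exact huB), hgg]
        · rw [if_neg hgB, if_neg hgB]
    have hcast : ((∑ u ∈ B.filter (fun u => u ∉ (range ℓ).image c.v), c.W₁ u.1 u.2 : ℤ) : ZMod 2) = 0 := by
      rw [Int.cast_sum]; exact key
    exact (ZMod.intCast_zmod_eq_zero_iff_dvd _ 2).1 hcast
  -- arithmetic
  have hshoe : c.shoelace = ∑ j ∈ Finset.range ℓ, ((v j).1 * (v (j + 1)).2 - (v (j + 1)).1 * (v j).2) := rfl
  rw [← hshoe]
  obtain ⟨k, hk⟩ := hev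
  obtain ⟨I', hI⟩ := heven
  rw [hI] at h8
  have hlin : (ℓ : ℤ) * (8 * c.Wrf (c.v 0) (c.v 1) + 4) = 16 * ((k : ℤ) * c.Wrf (c.v 0) (c.v 1)) + 8 * k := by
    have hk' : (ℓ : ℤ) = k + k := by exact_mod_cast hk
    rw [hk']; ring
  rw [hlin] at h8
  generalize (k : ℤ) * c.Wrf (c.v 0) (c.v 1) = M at h8
  generalize c.shoelace = S at h8 ⊢
  rcases hT with hT | hT <;> rw [hT] at h8 <;> omega

end Summit.ValiantsHypothesis.ValiantsHypothesis.Theorems.DivisionGapZeroOneTransfer
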